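import Literature.NumberTheory.GaloisRepresentations.AbsDecompositionFiniteLevelDictionary
import Literature.AnabelianGeometry.AbsoluteAnabelian.NeukirchUchidaTransportGamma
import Mathlib.NumberTheory.RamificationInertia.Basic
import Mathlib.FieldTheory.KrullTopology
import HarnessLib

/-!
# Degrees and degree-one primes are invariants of a correspondence of nonarchimedean primes
# (Neukirch–Uchida deduction, row R4: the counting half)

J. Neukirch, A. Schmidt, K. Wingberg, *Cohomology of Number Fields* (2nd ed.), Ch. XII §2, proof of
Thm. (12.2.1) (Neukirch–Uchida): once an isomorphism `α : U₁ ⥲ U₂` of open subgroups of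
`Γ = Gal(F̄/F)` is known to induce a CORRESPONDENCE `A ↦ B` of the nonarchimedean primes of `F̄`
(row R1) which is equivariant for the fixing groups `Γ_K → Γ_{K'}` of two finite subextensions
`K, K' ⊆ F̄`, respects «`A` lies over the place `v` of `F`» (row R2, residue characteristic) and
preserves the local degree `e·f` of the primes of `K`, `K'` below corresponding `A`, `B` (row R2 +
row R3's index identity), the ARITHMETIC-EQUIVALENCE DATA follow by COUNTING: `K` and `K'` have the
same number of primes over `v` with the same local degrees, hence (fundamental identity
`Σ_{P ∣ v} e_P f_P = [K : F]`, Neukirch I (8.2)) the same degree, and a prime of `v` of degree one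
in `K'` forces one in `K` (the input of M. Bauer's theorem, row R5/R6).

PROOF-ONLY (no `def`).  abc-iut cell, GAP-LEDGER row G-L4d2g4-1, sub-DAG
`plan/L4/SUBDAG-NeukirchUchida.md`, row R4 (holder abc-iut-L4-d2), counting sub-brick «R4a» (seat
abc-iut-w6-d108, on abc-iut-w5-d201's pointer).  The correspondence is an ABSTRACT RELATION
`Rel : ValuationSubring F̄ → ValuationSubring F̄ → Prop` with five displayed hypotheses — (R0)/(R0′)
totality both ways on nontrivial primes over `v`, (R1) `Γ_K`-orbits ↔ `Γ_{K'}`-orbits, (R2) «over `v`»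
preserved, (R3) `e·f` preserved — which the holder instantiates with `Corr α`
(`NeukirchUchidaPrimeCorrespondence`, p446402) and the local invariants of row R2; everything else is
abc-iut-w5-d201's dictionary `AbsDecompositionFiniteLevelDictionary` (p449795) and Mathlib's
fundamental identity.  Currency: `F : Type` a number field, `F̄ = AlgebraicClosure F`,
`Γ_K := K.fixingSubgroup.comap (absoluteGaloisGroup.toAlgEquiv F).toMonoidHom`,
«`A` below `P` in `K`» := `∀ x : 𝓞 K, ((x : K) : F̄) ∈ A.nonunits ↔ x ∈ P`,
«`A` over `v`» := `∀ r : 𝓞 F, algebraMap F F̄ r ∈ A.nonunits ↔ r ∈ v.asIdeal`,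
`e, f` = Mathlib `Ideal.ramificationIdx (𝓞 F)`, `Ideal.inertiaDeg (𝓞 F)` (Bauer's currency, p445734).

* `sum_primesOverFinset_ramificationIdx_mul_inertiaDeg_eq_finrank` — the fundamental identity
  `Σ_{P ∣ v} e(P) f(P) = [K : F]` in this currency (Mathlib `Ideal.sum_ramification_inertia`);
* `exists_degOne_of_exists_degOne_of_rel` — **P₁-TRANSFER** (row R4 OUT (ii) = row R6's `hP₁`): a prime
  of `𝓞 K'` over `v` with `e = f = 1` yields one of `𝓞 K` (uses (R0′), (R2), (R3) only);
* **`sum_ramificationIdx_mul_inertiaDeg_eq_of_rel`** — `Σ_{P ∣ v, P ⊆ 𝓞 K} e f = Σ_{P' ∣ v, P' ⊆ 𝓞 K'} e f`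
  (`Finset.sum_bij` along `P ↦` the prime below the partner of a prime above `P`);
* **`finrank_eq_of_rel`** — `[K : F] = [K' : F]` (row R4 OUT (i)); `index_fixingSubgroup_comap_eq_of_rel`
  — `[Γ : Γ_K] = [Γ : Γ_{K'}]` (row R4 OUT «`[Γ : U₁] = [Γ : U₂]`» at `K = K_{U₁}`, `K' = K_{U₂}`);
* `finrank_eq_of_rel_rat`, `exists_degOne_of_exists_degOne_of_rel_rat` — the same at base `ℚ` in the
  sub-DAG's `ΓK`-spelling (abc-iut-w6-d055, `NeukirchUchidaTransportGamma`).

HONEST FRAMING: classical algebraic number theory (Hilbert's ramification theory + counting), outside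
the [IUTchIII] Cor. 3.12 cone; nothing here takes a side; the correspondence data are hypotheses.

## References
* [NeukirchSchmidtWingberg2008] Neukirch–Schmidt–Wingberg, *Cohomology of Number Fields*, Thm (12.2.1) and its proof.
* [NeukirchANT1999] J. Neukirch, *Algebraic Number Theory*, Ch. I (8.2) (fundamental identity), Ch. I §9, Ch. VII (13.9).
-/

noncomputable section

open Field NumberField IsDedekindDomain
open scoped Pointwise

namespace Literature.NumberTheory.GaloisRepresentations

namespace NeukirchUchidaProof

variable {F : Type} [Field F] [NumberField F]

/-! ### The fundamental identity in the `Ideal.ramificationIdx (𝓞 F)` / `Ideal.inertiaDeg (𝓞 F)` currency -/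

/-- **Fundamental identity** `Σ_{P ∣ v} e(P|v)·f(P|v) = [K : F]` over the primes of `𝓞 K` above the
finite place `v` of `F`, for a finite subextension `K ⊆ F̄`, in Mathlib's `Ideal.ramificationIdx (𝓞 F)` /
`Ideal.inertiaDeg (𝓞 F)` currency (from `Ideal.sum_ramification_inertia`).
[cite: NeukirchANT1999, Ch. I Prop. (8.2)] -/
theorem sum_primesOverFinset_ramificationIdx_mul_inertiaDeg_eq_finrank
    (K : IntermediateField F (AlgebraicClosure F)) [FiniteDimensional F K] [NumberField K]
    (v : HeightOneSpectrum (𝓞 F)) :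
    ∑ P ∈ IsDedekindDomain.primesOverFinset v.asIdeal (𝓞 K), P.ramificationIdx (𝓞 F) * P.inertiaDeg (𝓞 F) =
      Module.finrank F K := by
  classical
  haveI := v.isMaximal
  rw [← Ideal.sum_ramification_inertia (R := 𝓞 F) (𝓞 K) F K (p := v.asIdeal) v.ne_bot]
  refine Finset.sum_congr rfl fun P hP => ?_
  rw [IsDedekindDomain.mem_primesOverFinset_iff v.ne_bot] at hP
  haveI := hP.1
  haveI := hP.2
  haveI : P.IsMaximal := hP.1.isMaximal (Ideal.ne_bot_of_liesOver_of_ne_bot v.ne_bot P)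
  rw [Ideal.ramificationIdx'_eq_ramificationIdx (p := v.asIdeal) (q := P) v.ne_bot,
    Ideal.inertiaDeg'_eq_inertiaDeg (p := v.asIdeal) (q := P)]

/-! ### Transfer along a correspondence of nonarchimedean primes -/

section Transfer

variable (K K' : IntermediateField F (AlgebraicClosure F)) [FiniteDimensional F K] [NumberField K]
  [FiniteDimensional F K'] [NumberField K'] (Rel : ValuationSubring (AlgebraicClosure F) →
    ValuationSubring (AlgebraicClosure F) → Prop) (v : HeightOneSpectrum (𝓞 F))

omit [NumberField F] [FiniteDimensional F K] [NumberField K] [FiniteDimensional F K'] [NumberField K'] in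
/-- A prime over `v` having a valuation subring `B` above it makes `B` lie over `v`. [folklore] -/
private theorem over_of_below_of_mem_primesOver (L : IntermediateField F (AlgebraicClosure F))
    {B : ValuationSubring (AlgebraicClosure F)} {P : Ideal (𝓞 L)}
    (hPB : ∀ x : 𝓞 L, ((x : L) : AlgebraicClosure F) ∈ B.nonunits ↔ x ∈ P)
    (hP : P ∈ v.asIdeal.primesOver (𝓞 L)) :
    ∀ r : 𝓞 F, algebraMap F (AlgebraicClosure F) r ∈ B.nonunits ↔ r ∈ v.asIdeal := by
  intro r
  haveI := hP.2
  rw [← mem_under_of_below L B hPB r, ← Ideal.LiesOver.over (p := v.asIdeal) (P := P)]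

omit [NumberField K] [FiniteDimensional F K'] in
/-- **P₁-TRANSFER** (row R4 OUT (ii); the hypothesis `hP₁` of row R6): along a correspondence `Rel` of
nonarchimedean primes which is total from the `K'`-side over `v` (R0′), preserves «over `v`» (R2) and
preserves the local degree `e·f` of the primes below (R3), a prime of `𝓞 K'` over `v` with
`e = f = 1` yields a prime of `𝓞 K` over `v` with `e = f = 1` (`e·f = 1` forces `e = f = 1`).
[cite: NeukirchSchmidtWingberg2008, Thm (12.2.1)] [cite: NeukirchANT1999, Ch. VII Prop. (13.9)] -/
theorem exists_degOne_of_exists_degOne_of_rel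
    (hR0' : ∀ B : ValuationSubring (AlgebraicClosure F), B ≠ ⊤ →
      (∀ r : 𝓞 F, algebraMap F (AlgebraicClosure F) r ∈ B.nonunits ↔ r ∈ v.asIdeal) →
        ∃ A : ValuationSubring (AlgebraicClosure F), A ≠ ⊤ ∧ Rel A B)
    (hR2 : ∀ A B, Rel A B →
      ((∀ r : 𝓞 F, algebraMap F (AlgebraicClosure F) r ∈ A.nonunits ↔ r ∈ v.asIdeal) ↔
        (∀ r : 𝓞 F, algebraMap F (AlgebraicClosure F) r ∈ B.nonunits ↔ r ∈ v.asIdeal)))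
    (hR3 : ∀ A B (P : Ideal (𝓞 K)) (P' : Ideal (𝓞 K')), Rel A B → A ≠ ⊤ →
      (∀ x : 𝓞 K, ((x : K) : AlgebraicClosure F) ∈ A.nonunits ↔ x ∈ P) →
      (∀ x : 𝓞 K', ((x : K') : AlgebraicClosure F) ∈ B.nonunits ↔ x ∈ P') →
        P.ramificationIdx (𝓞 F) * P.inertiaDeg (𝓞 F) = P'.ramificationIdx (𝓞 F) * P'.inertiaDeg (𝓞 F))
    (h : ∃ P' ∈ v.asIdeal.primesOver (𝓞 K'), P'.ramificationIdx (𝓞 F) = 1 ∧ P'.inertiaDeg (𝓞 F) = 1) :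
    ∃ P ∈ v.asIdeal.primesOver (𝓞 K), P.ramificationIdx (𝓞 F) = 1 ∧ P.inertiaDeg (𝓞 F) = 1 := by
  obtain ⟨P', hP', he', hf'⟩ := h
  haveI := hP'.1
  haveI := hP'.2
  haveI : P'.IsMaximal := hP'.1.isMaximal (Ideal.ne_bot_of_liesOver_of_ne_bot v.ne_bot P')
  obtain ⟨B, hB, hP'B⟩ := exists_valuationSubring_below K' P'
  have hBv := over_of_below_of_mem_primesOver v K' hP'B hP'
  obtain ⟨A, hA, hAB⟩ := hR0' B hB hBv
  have hAv := (hR2 A B hAB).mpr hBv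
  obtain ⟨P, hPA, -⟩ := existsUnique_ideal_below K A
  refine ⟨P, mem_primesOver_of_below K hA hPA hAv, ?_⟩
  have h1 := hR3 A B P P' hAB hA hPA hP'B
  rw [he', hf', mul_one] at h1
  exact ⟨Nat.eq_one_of_mul_eq_one_right h1, Nat.eq_one_of_mul_eq_one_left h1⟩

/-- **EQUAL PRIME COUNTS WITH MULTIPLICITY `e·f`** along a correspondence (rows R1 + R2 ⇒ R4): if `Rel`
is total both ways on the nontrivial primes over `v` ((R0), (R0′)), matches `Γ_K`-orbits with
`Γ_{K'}`-orbits ((R1): for two related pairs `(A,B)`, `(A₂,B₂)`, `A₂ ∈ Γ_K • A ↔ B₂ ∈ Γ_{K'} • B`),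
preserves «over `v`» (R2) and preserves `e·f` of the primes below (R3), then
`Σ_{P ∣ v in 𝓞 K} e(P) f(P) = Σ_{P' ∣ v in 𝓞 K'} e(P') f(P')`.  The bijection of primes is
`P ↦` (the prime of `𝓞 K'` below the partner of a prime of `F̄` above `P`); it is well defined and
bijective by (R1) and the dictionary «primes of `𝓞 K` over `v` ↔ `Γ_K`-orbits of primes of `F̄`»
(`existsUnique_ideal_below`, `exists_smul_eq_of_below`, `below_smul_of_mem`, abc-iut-w5-d201).
[cite: NeukirchSchmidtWingberg2008, Thm (12.2.1)] [cite: NeukirchANT1999, Ch. I §9 Prop. (9.1)] -/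
theorem sum_ramificationIdx_mul_inertiaDeg_eq_of_rel
    (hR0 : ∀ A : ValuationSubring (AlgebraicClosure F), A ≠ ⊤ →
      (∀ r : 𝓞 F, algebraMap F (AlgebraicClosure F) r ∈ A.nonunits ↔ r ∈ v.asIdeal) →
        ∃ B : ValuationSubring (AlgebraicClosure F), B ≠ ⊤ ∧ Rel A B)
    (hR0' : ∀ B : ValuationSubring (AlgebraicClosure F), B ≠ ⊤ →
      (∀ r : 𝓞 F, algebraMap F (AlgebraicClosure F) r ∈ B.nonunits ↔ r ∈ v.asIdeal) →
        ∃ A : ValuationSubring (AlgebraicClosure F), A ≠ ⊤ ∧ Rel A B)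
    (hR1 : ∀ A B A₂ B₂, Rel A B → Rel A₂ B₂ →
      ((∃ u ∈ K.fixingSubgroup.comap (absoluteGaloisGroup.toAlgEquiv F).toMonoidHom, u • A = A₂) ↔
        (∃ w ∈ K'.fixingSubgroup.comap (absoluteGaloisGroup.toAlgEquiv F).toMonoidHom, w • B = B₂)))
    (hR2 : ∀ A B, Rel A B →
      ((∀ r : 𝓞 F, algebraMap F (AlgebraicClosure F) r ∈ A.nonunits ↔ r ∈ v.asIdeal) ↔
        (∀ r : 𝓞 F, algebraMap F (AlgebraicClosure F) r ∈ B.nonunits ↔ r ∈ v.asIdeal)))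
    (hR3 : ∀ A B (P : Ideal (𝓞 K)) (P' : Ideal (𝓞 K')), Rel A B → A ≠ ⊤ →
      (∀ x : 𝓞 K, ((x : K) : AlgebraicClosure F) ∈ A.nonunits ↔ x ∈ P) →
      (∀ x : 𝓞 K', ((x : K') : AlgebraicClosure F) ∈ B.nonunits ↔ x ∈ P') →
        P.ramificationIdx (𝓞 F) * P.inertiaDeg (𝓞 F) = P'.ramificationIdx (𝓞 F) * P'.inertiaDeg (𝓞 F)) :
    ∑ P ∈ IsDedekindDomain.primesOverFinset v.asIdeal (𝓞 K), P.ramificationIdx (𝓞 F) * P.inertiaDeg (𝓞 F) =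
      ∑ P' ∈ IsDedekindDomain.primesOverFinset v.asIdeal (𝓞 K'),
        P'.ramificationIdx (𝓞 F) * P'.inertiaDeg (𝓞 F) := by
  classical
  haveI := v.isMaximal
  set s := IsDedekindDomain.primesOverFinset v.asIdeal (𝓞 K) with hs
  set t := IsDedekindDomain.primesOverFinset v.asIdeal (𝓞 K') with ht
  have hs' : ∀ P : Ideal (𝓞 K), P ∈ s ↔ P ∈ v.asIdeal.primesOver (𝓞 K) := fun P =>
    IsDedekindDomain.mem_primesOverFinset_iff v.ne_bot (𝓞 K)
  have ht' : ∀ P' : Ideal (𝓞 K'), P' ∈ t ↔ P' ∈ v.asIdeal.primesOver (𝓞 K') := fun P' =>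
    IsDedekindDomain.mem_primesOverFinset_iff v.ne_bot (𝓞 K')
  -- a valuation subring `A P` above each `P ∣ v` of `𝓞 K`
  have hAex : ∀ P : Ideal (𝓞 K), P ∈ s → ∃ A : ValuationSubring (AlgebraicClosure F), A ≠ ⊤ ∧
      ∀ x : 𝓞 K, ((x : K) : AlgebraicClosure F) ∈ A.nonunits ↔ x ∈ P := by
    intro P hP
    rw [hs'] at hP
    haveI := hP.1
    haveI := hP.2
    haveI : P.IsMaximal := hP.1.isMaximal (Ideal.ne_bot_of_liesOver_of_ne_bot v.ne_bot P)
    exact exists_valuationSubring_below K P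
  choose! A hA using hAex
  have hAv : ∀ P ∈ s, ∀ r : 𝓞 F, algebraMap F (AlgebraicClosure F) r ∈ (A P).nonunits ↔ r ∈ v.asIdeal :=
    fun P hP => over_of_below_of_mem_primesOver v K (hA P hP).2 ((hs' P).mp hP)
  -- its partner `B P` and the prime `Φ P` of `𝓞 K'` below the partner
  have hBex : ∀ P : Ideal (𝓞 K), P ∈ s → ∃ B : ValuationSubring (AlgebraicClosure F), B ≠ ⊤ ∧ Rel (A P) B :=
    fun P hP => hR0 _ (hA P hP).1 (hAv P hP)
  choose! B hB using hBex
  have hΦex : ∀ P : Ideal (𝓞 K), P ∈ s → ∃ P' : Ideal (𝓞 K'),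
      ∀ x : 𝓞 K', ((x : K') : AlgebraicClosure F) ∈ (B P).nonunits ↔ x ∈ P' :=
    fun P _ => (existsUnique_ideal_below K' (B P)).exists
  choose! Φ hΦ using hΦex
  have hBv : ∀ P ∈ s, ∀ r : 𝓞 F, algebraMap F (AlgebraicClosure F) r ∈ (B P).nonunits ↔ r ∈ v.asIdeal :=
    fun P hP => (hR2 _ _ (hB P hP).2).mp (hAv P hP)
  have hΦt : ∀ P (hP : P ∈ s), Φ P ∈ t := fun P hP =>
    (ht' _).mpr (mem_primesOver_of_below K' (hB P hP).1 (hΦ P hP) (hBv P hP))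
  refine Finset.sum_bij (fun P _ => Φ P) hΦt ?_ ?_ ?_
  · -- injective: partners below the same prime are `Γ_{K'}`-conjugate, so the `A`'s are `Γ_K`-conjugate
    intro P₁ hP₁ P₂ hP₂ h12
    have h12' : ∀ x : 𝓞 K', ((x : K') : AlgebraicClosure F) ∈ (B P₂).nonunits ↔ x ∈ Φ P₁ := by
      intro x; rw [h12]; exact hΦ P₂ hP₂ x
    obtain ⟨w, hw, hwB⟩ := exists_smul_eq_of_below K' (hB P₂ hP₂).1 (hΦ P₁ hP₁) h12'
    obtain ⟨u, hu, huA⟩ := (hR1 _ _ _ _ (hB P₁ hP₁).2 (hB P₂ hP₂).2).mpr ⟨w, hw, hwB⟩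
    have h1 : ∀ x : 𝓞 K, ((x : K) : AlgebraicClosure F) ∈ (A P₂).nonunits ↔ x ∈ P₁ := by
      intro x; rw [← huA]; exact below_smul_of_mem K hu (hA P₁ hP₁).2 x
    exact (existsUnique_ideal_below K (A P₂)).unique h1 (hA P₂ hP₂).2
  · -- surjective: pull a prime `P' ∣ v` of `𝓞 K'` back through a partner of a valuation subring above it
    intro P' hP'
    have hP'' := (ht' P').mp hP'
    haveI := hP''.1
    haveI := hP''.2
    haveI : P'.IsMaximal := hP''.1.isMaximal (Ideal.ne_bot_of_liesOver_of_ne_bot v.ne_bot P')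
    obtain ⟨B₀, hB₀, hP'B₀⟩ := exists_valuationSubring_below K' P'
    have hB₀v := over_of_below_of_mem_primesOver v K' hP'B₀ hP''
    obtain ⟨A₀, hA₀, hA₀B₀⟩ := hR0' B₀ hB₀ hB₀v
    have hA₀v := (hR2 A₀ B₀ hA₀B₀).mpr hB₀v
    obtain ⟨P, hPA₀, -⟩ := existsUnique_ideal_below K A₀
    have hPs : P ∈ s := (hs' P).mpr (mem_primesOver_of_below K hA₀ hPA₀ hA₀v)
    refine ⟨P, hPs, ?_⟩
    -- `A P` and `A₀` lie above `P`: `u • A P = A₀` for some `u ∈ Γ_K`, hence `w • B P = B₀`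
    obtain ⟨u, hu, huA⟩ := exists_smul_eq_of_below K hA₀ (hA P hPs).2 hPA₀
    obtain ⟨w, hw, hwB⟩ := (hR1 _ _ _ _ (hB P hPs).2 hA₀B₀).mp ⟨u, hu, huA⟩
    have h1 : ∀ x : 𝓞 K', ((x : K') : AlgebraicClosure F) ∈ B₀.nonunits ↔ x ∈ Φ P := by
      intro x; rw [← hwB]; exact below_smul_of_mem K' hw (hΦ P hPs) x
    exact (existsUnique_ideal_below K' B₀).unique h1 hP'B₀
  · -- the summands agree
    intro P hP
    exact hR3 _ _ _ _ (hB P hP).2 (hA P hP).1 (hA P hP).2 (hΦ P hP)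

/-- **EQUAL DEGREES** (row R4 OUT (i)): under (R0), (R0′), (R1), (R2), (R3) at ONE finite place `v`,
`[K : F] = [K' : F]` (fundamental identity on both sides of `sum_ramificationIdx_mul_inertiaDeg_eq_of_rel`).
[cite: NeukirchSchmidtWingberg2008, Thm (12.2.1)] [cite: NeukirchANT1999, Ch. I Prop. (8.2)] -/
theorem finrank_eq_of_rel
    (hR0 : ∀ A : ValuationSubring (AlgebraicClosure F), A ≠ ⊤ →
      (∀ r : 𝓞 F, algebraMap F (AlgebraicClosure F) r ∈ A.nonunits ↔ r ∈ v.asIdeal) →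
        ∃ B : ValuationSubring (AlgebraicClosure F), B ≠ ⊤ ∧ Rel A B)
    (hR0' : ∀ B : ValuationSubring (AlgebraicClosure F), B ≠ ⊤ →
      (∀ r : 𝓞 F, algebraMap F (AlgebraicClosure F) r ∈ B.nonunits ↔ r ∈ v.asIdeal) →
        ∃ A : ValuationSubring (AlgebraicClosure F), A ≠ ⊤ ∧ Rel A B)
    (hR1 : ∀ A B A₂ B₂, Rel A B → Rel A₂ B₂ →
      ((∃ u ∈ K.fixingSubgroup.comap (absoluteGaloisGroup.toAlgEquiv F).toMonoidHom, u • A = A₂) ↔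
        (∃ w ∈ K'.fixingSubgroup.comap (absoluteGaloisGroup.toAlgEquiv F).toMonoidHom, w • B = B₂)))
    (hR2 : ∀ A B, Rel A B →
      ((∀ r : 𝓞 F, algebraMap F (AlgebraicClosure F) r ∈ A.nonunits ↔ r ∈ v.asIdeal) ↔
        (∀ r : 𝓞 F, algebraMap F (AlgebraicClosure F) r ∈ B.nonunits ↔ r ∈ v.asIdeal)))
    (hR3 : ∀ A B (P : Ideal (𝓞 K)) (P' : Ideal (𝓞 K')), Rel A B → A ≠ ⊤ →
      (∀ x : 𝓞 K, ((x : K) : AlgebraicClosure F) ∈ A.nonunits ↔ x ∈ P) →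
      (∀ x : 𝓞 K', ((x : K') : AlgebraicClosure F) ∈ B.nonunits ↔ x ∈ P') →
        P.ramificationIdx (𝓞 F) * P.inertiaDeg (𝓞 F) = P'.ramificationIdx (𝓞 F) * P'.inertiaDeg (𝓞 F)) :
    Module.finrank F K = Module.finrank F K' := by
  rw [← sum_primesOverFinset_ramificationIdx_mul_inertiaDeg_eq_finrank K v,
    ← sum_primesOverFinset_ramificationIdx_mul_inertiaDeg_eq_finrank K' v]
  exact sum_ramificationIdx_mul_inertiaDeg_eq_of_rel K K' Rel v hR0 hR0' hR1 hR2 hR3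

/-- `[K : F] = [Γ : Γ_K]` for a finite subextension `K ⊆ F̄` (Krull/Galois correspondence, Mathlib
`IntermediateField.finrank_eq_fixingSubgroup_index`, read in `Γ = Field.absoluteGaloisGroup F`).
[cite: NeukirchANT1999, Ch. IV §1] -/
theorem finrank_eq_index_fixingSubgroup_comap (L : IntermediateField F (AlgebraicClosure F)) :
    Module.finrank F L = (L.fixingSubgroup.comap (absoluteGaloisGroup.toAlgEquiv F).toMonoidHom).index := by
  haveI : IsGalois F (AlgebraicClosure F) := IsAlgClosure.isGalois F (AlgebraicClosure F)
  rw [Subgroup.index_comap_of_surjective _ (absoluteGaloisGroup.toAlgEquiv F).surjective,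
    IntermediateField.finrank_eq_fixingSubgroup_index]

/-- **EQUAL INDICES** `[Γ : Γ_K] = [Γ : Γ_{K'}]` (row R4 OUT «`[Γ : U₁] = [Γ : U₂]`» at `K = K_{U₁}`,
`K' = K_{U₂}`). [cite: NeukirchSchmidtWingberg2008, Thm (12.2.1)] -/
theorem index_fixingSubgroup_comap_eq_of_rel
    (hR0 : ∀ A : ValuationSubring (AlgebraicClosure F), A ≠ ⊤ →
      (∀ r : 𝓞 F, algebraMap F (AlgebraicClosure F) r ∈ A.nonunits ↔ r ∈ v.asIdeal) →
        ∃ B : ValuationSubring (AlgebraicClosure F), B ≠ ⊤ ∧ Rel A B)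
    (hR0' : ∀ B : ValuationSubring (AlgebraicClosure F), B ≠ ⊤ →
      (∀ r : 𝓞 F, algebraMap F (AlgebraicClosure F) r ∈ B.nonunits ↔ r ∈ v.asIdeal) →
        ∃ A : ValuationSubring (AlgebraicClosure F), A ≠ ⊤ ∧ Rel A B)
    (hR1 : ∀ A B A₂ B₂, Rel A B → Rel A₂ B₂ →
      ((∃ u ∈ K.fixingSubgroup.comap (absoluteGaloisGroup.toAlgEquiv F).toMonoidHom, u • A = A₂) ↔
        (∃ w ∈ K'.fixingSubgroup.comap (absoluteGaloisGroup.toAlgEquiv F).toMonoidHom, w • B = B₂)))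
    (hR2 : ∀ A B, Rel A B →
      ((∀ r : 𝓞 F, algebraMap F (AlgebraicClosure F) r ∈ A.nonunits ↔ r ∈ v.asIdeal) ↔
        (∀ r : 𝓞 F, algebraMap F (AlgebraicClosure F) r ∈ B.nonunits ↔ r ∈ v.asIdeal)))
    (hR3 : ∀ A B (P : Ideal (𝓞 K)) (P' : Ideal (𝓞 K')), Rel A B → A ≠ ⊤ →
      (∀ x : 𝓞 K, ((x : K) : AlgebraicClosure F) ∈ A.nonunits ↔ x ∈ P) →
      (∀ x : 𝓞 K', ((x : K') : AlgebraicClosure F) ∈ B.nonunits ↔ x ∈ P') →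
        P.ramificationIdx (𝓞 F) * P.inertiaDeg (𝓞 F) = P'.ramificationIdx (𝓞 F) * P'.inertiaDeg (𝓞 F)) :
    (K.fixingSubgroup.comap (absoluteGaloisGroup.toAlgEquiv F).toMonoidHom).index =
      (K'.fixingSubgroup.comap (absoluteGaloisGroup.toAlgEquiv F).toMonoidHom).index := by
  rw [← finrank_eq_index_fixingSubgroup_comap K, ← finrank_eq_index_fixingSubgroup_comap K']
  exact finrank_eq_of_rel K K' Rel v hR0 hR0' hR1 hR2 hR3

end Transfer

/-! ### The sub-DAG's `ℚ`-currency (`Γ = G_ℚ`, `ΓK` of `NeukirchUchidaTransportGamma`) -/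

section Rat

open Literature.AnabelianGeometry.AbsoluteAnabelian.NeukirchUchidaProof (ΓK ΓK_eq_comap)

variable (K K' : IntermediateField ℚ (AlgebraicClosure ℚ)) [FiniteDimensional ℚ K] [NumberField K]
  [FiniteDimensional ℚ K'] [NumberField K'] (Rel : ValuationSubring (AlgebraicClosure ℚ) →
    ValuationSubring (AlgebraicClosure ℚ) → Prop) (v : HeightOneSpectrum (𝓞 ℚ))

/-- **Row R4 OUT (i) at base `ℚ`, `ΓK`-spelling**: `finrank ℚ K = finrank ℚ K'` along a correspondence
with (R0), (R0′), (R1) for `ΓK K` / `ΓK K'`, (R2), (R3). [cite: NeukirchSchmidtWingberg2008, Thm (12.2.1)] -/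
theorem finrank_eq_of_rel_rat
    (hR0 : ∀ A : ValuationSubring (AlgebraicClosure ℚ), A ≠ ⊤ →
      (∀ r : 𝓞 ℚ, algebraMap ℚ (AlgebraicClosure ℚ) r ∈ A.nonunits ↔ r ∈ v.asIdeal) →
        ∃ B : ValuationSubring (AlgebraicClosure ℚ), B ≠ ⊤ ∧ Rel A B)
    (hR0' : ∀ B : ValuationSubring (AlgebraicClosure ℚ), B ≠ ⊤ →
      (∀ r : 𝓞 ℚ, algebraMap ℚ (AlgebraicClosure ℚ) r ∈ B.nonunits ↔ r ∈ v.asIdeal) →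
        ∃ A : ValuationSubring (AlgebraicClosure ℚ), A ≠ ⊤ ∧ Rel A B)
    (hR1 : ∀ A B A₂ B₂, Rel A B → Rel A₂ B₂ →
      ((∃ u ∈ ΓK K, u • A = A₂) ↔ (∃ w ∈ ΓK K', w • B = B₂)))
    (hR2 : ∀ A B, Rel A B →
      ((∀ r : 𝓞 ℚ, algebraMap ℚ (AlgebraicClosure ℚ) r ∈ A.nonunits ↔ r ∈ v.asIdeal) ↔
        (∀ r : 𝓞 ℚ, algebraMap ℚ (AlgebraicClosure ℚ) r ∈ B.nonunits ↔ r ∈ v.asIdeal)))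
    (hR3 : ∀ A B (P : Ideal (𝓞 K)) (P' : Ideal (𝓞 K')), Rel A B → A ≠ ⊤ →
      (∀ x : 𝓞 K, ((x : K) : AlgebraicClosure ℚ) ∈ A.nonunits ↔ x ∈ P) →
      (∀ x : 𝓞 K', ((x : K') : AlgebraicClosure ℚ) ∈ B.nonunits ↔ x ∈ P') →
        P.ramificationIdx (𝓞 ℚ) * P.inertiaDeg (𝓞 ℚ) = P'.ramificationIdx (𝓞 ℚ) * P'.inertiaDeg (𝓞 ℚ)) :
    Module.finrank ℚ K = Module.finrank ℚ K' := by
  refine finrank_eq_of_rel K K' Rel v hR0 hR0' (fun A B A₂ B₂ h h₂ => ?_) hR2 hR3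
  have key := hR1 A B A₂ B₂ h h₂
  simp only [ΓK_eq_comap] at key
  exact key

omit [NumberField K] [FiniteDimensional ℚ K'] in
/-- **Row R4 OUT (ii) at base `ℚ`** (= row R6's `hP₁`): degree-one primes over `v` transfer from `K'` to
`K`. [cite: NeukirchSchmidtWingberg2008, Thm (12.2.1)] -/
theorem exists_degOne_of_exists_degOne_of_rel_rat
    (hR0' : ∀ B : ValuationSubring (AlgebraicClosure ℚ), B ≠ ⊤ →
      (∀ r : 𝓞 ℚ, algebraMap ℚ (AlgebraicClosure ℚ) r ∈ B.nonunits ↔ r ∈ v.asIdeal) →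
        ∃ A : ValuationSubring (AlgebraicClosure ℚ), A ≠ ⊤ ∧ Rel A B)
    (hR2 : ∀ A B, Rel A B →
      ((∀ r : 𝓞 ℚ, algebraMap ℚ (AlgebraicClosure ℚ) r ∈ A.nonunits ↔ r ∈ v.asIdeal) ↔
        (∀ r : 𝓞 ℚ, algebraMap ℚ (AlgebraicClosure ℚ) r ∈ B.nonunits ↔ r ∈ v.asIdeal)))
    (hR3 : ∀ A B (P : Ideal (𝓞 K)) (P' : Ideal (𝓞 K')), Rel A B → A ≠ ⊤ →
      (∀ x : 𝓞 K, ((x : K) : AlgebraicClosure ℚ) ∈ A.nonunits ↔ x ∈ P) →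
      (∀ x : 𝓞 K', ((x : K') : AlgebraicClosure ℚ) ∈ B.nonunits ↔ x ∈ P') →
        P.ramificationIdx (𝓞 ℚ) * P.inertiaDeg (𝓞 ℚ) = P'.ramificationIdx (𝓞 ℚ) * P'.inertiaDeg (𝓞 ℚ))
    (h : ∃ P' ∈ v.asIdeal.primesOver (𝓞 K'), P'.ramificationIdx (𝓞 ℚ) = 1 ∧ P'.inertiaDeg (𝓞 ℚ) = 1) :
    ∃ P ∈ v.asIdeal.primesOver (𝓞 K), P.ramificationIdx (𝓞 ℚ) = 1 ∧ P.inertiaDeg (𝓞 ℚ) = 1 :=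
  exists_degOne_of_exists_degOne_of_rel K K' Rel v hR0' hR2 hR3 h

end Rat

end NeukirchUchidaProof

end Literature.NumberTheory.GaloisRepresentations

end
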